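import Literature.Barriers.CriticalPhenomena.LaceExpansionHighDimensionOneArm
import Literature.Probability.Percolation.MagnetizationLowerBound
import HarnessLib

/-!
# The `d ≥ 6` one-arm barrier, unconditionally: the magnetization hypothesis discharged

Topic `Literature/Barriers/CriticalPhenomena`, summit `CriticalPhenomena`. The barrier
`six_le_of_oneArm_upper_of_magnetization` / `MeanFieldOneArmHighDimension`
(`LaceExpansionHighDimensionOneArm.lean`) — "the one-arm upper bound `P_{p_c}(0 ↔ ∂Λ_n) ≤ C/n²`
forces `d ≥ 6`" (Dewan–Muirhead 2022, §1.1; the hyperscaling inequality `η₁ ≤ d/(1+δ)` at `η₁ = 2`)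
— was stated GRANTED the Aizenman–Barsky magnetization bound `M(p_c,γ) ≥ c√γ`
(Aizenman–Barsky 1987, Thm. 1.2: `δ ≥ 2` in the generating-function sense). That bound is now a
theorem of this library for every `d ≥ 2`
(`Literature.Probability.Percolation.magnetization_criticalProb_ge_sqrt`, `MagnetizationLowerBound.lean`,
proved along Newman 1987 / Grimmett 1999 Prop. (10.29), second proof), so the barrier holds with no
hypothesis beyond the one-arm bound itself:

* `six_le_of_oneArm_upper` — on `ℤ^d`, `d ≥ 2`: `P_{p_c}(0 ↔ ∂Λ_n) ≤ C/n²` for all `n ≥ 1` implies `6 ≤ d`;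
* `not_rhoExHalf_of_le_five` — `RhoExHalf d` (Heydenreich–van der Hofstad 2017, (11.3.2)) fails for
  every `2 ≤ d ≤ 5`.

- technique_class: any argument producing the mean-field one-arm upper bound `P_{p_c}(0 ↔ ∂Λ_n) ≤ C n^{-2}` on nearest-neighbour `ℤ^d` [cite: HeydenreichVanDerHofstad2017, Thm. 11.5 (11.3.2)].
- blocks: `RhoExHalf d` (indeed its upper half) for `2 ≤ d ≤ 5`, now UNCONDITIONALLY [cite: DewanMuirhead2022, §1.1 and Thm. 1.1].
- because: hyperscaling `η₁ ≤ d/(1+δ)` with `δ ≥ 2` [cite: AizenmanBarsky1987, Thm. 1.2] — the magnetization input is `magnetization_criticalProb_ge_sqrt` (this library), the squeeze is `six_le_of_oneArm_upper_of_magnetization` [cite: DewanMuirhead2022, §1.1].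
- evasions_known: none on nearest-neighbour `ℤ^d`, `d ≤ 5` (the conclusion is a theorem); see the parent file's block for other models [cite: HeydenreichVanDerHofstad2017, Thm. 15.8].
- scope_caveats: `d = 1` is not covered here (the magnetization theorem is stated for `d ≥ 2`; for `d = 1`, `p_c = 1`); says nothing about `d = 6`; nearest-neighbour bond percolation on `ℤ^d` only.
- status: established.

## References

* M. Aizenman, D. J. Barsky, Comm. Math. Phys. 108 (1987) 489–526: Thm. 1.2. [AizenmanBarsky1987]
* V. Dewan, S. Muirhead, *Upper bounds on the one-arm exponent for dependent percolation models*,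
  Probab. Theory Relat. Fields (2022): §1.1, Thm. 1.1. [DewanMuirhead2022]
* M. Heydenreich, R. van der Hofstad, Springer 2017: Thm. 11.5, Cor. 11.7. [HeydenreichVanDerHofstad2017]
-/

noncomputable section

namespace Literature.Barriers.CriticalPhenomena

open Literature.Probability.LatticeModels Literature.Probability.Percolation

variable {d : ℕ}

/-- **The `d ≥ 6` one-arm barrier, unconditional form**: on `ℤ^d`, `d ≥ 2`, the one-arm upper bound
`P_{p_c}(0 ↔ ∂Λ_n) ≤ C/n²` (`n ≥ 1`) implies `6 ≤ d` — `six_le_of_oneArm_upper_of_magnetization` with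
its magnetization hypothesis supplied by `magnetization_criticalProb_ge_sqrt`.
[cite: DewanMuirhead2022, §1.1 and Thm. 1.1] [cite: AizenmanBarsky1987, Thm. 1.2] -/
theorem six_le_of_oneArm_upper (hd : 2 ≤ d)
    (hρ : ∃ C : ℝ, ∀ n : ℕ, 1 ≤ n → oneArmProb d (criticalProbI d) n ≤ C / (n : ℝ) ^ 2) : 6 ≤ d :=
  six_le_of_oneArm_upper_of_magnetization (le_trans (by norm_num) hd) (criticalProbI d)
    (magnetization_criticalProb_ge_sqrt hd) hρ

/-- **`ρ_ex = 1/2` fails in every dimension `2 ≤ d ≤ 5`**, unconditionally (the parent file's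
`not_rhoExHalf_of_le_five_of_magnetization` with the magnetization bound discharged).
[cite: DewanMuirhead2022, §1.1 ("η₁ = 2 cannot occur for d ≤ 5")] [cite: AizenmanBarsky1987, Thm. 1.2]
[cite: HeydenreichVanDerHofstad2017, Thm. 11.5 (11.3.2)] -/
theorem not_rhoExHalf_of_le_five (hd2 : 2 ≤ d) (hd5 : d ≤ 5) : ¬ RhoExHalf d :=
  not_rhoExHalf_of_le_five_of_magnetization (le_trans (by norm_num) hd2) hd5
    (magnetization_criticalProb_ge_sqrt hd2)

/-- In particular `¬ RhoExHalf 3`: the mean-field one-arm law is excluded on `ℤ³` with no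
hypothesis. [cite: DewanMuirhead2022, §1.1] -/
theorem not_rhoExHalf_three : ¬ RhoExHalf 3 := not_rhoExHalf_of_le_five (by norm_num) (by norm_num)

/-- `MeanFieldOneArmHighDimension`'s conclusion with the magnetization hypothesis removed, for
`d ≥ 2`: `RhoExHalf d → 6 ≤ d`. [cite: HeydenreichVanDerHofstad2017, Cor. 11.7] [cite: DewanMuirhead2022, Thm. 1.1] -/
theorem RhoExHalf.six_le (hd : 2 ≤ d) (hρ : RhoExHalf d) : 6 ≤ d :=
  hρ.six_le_of_magnetization (le_trans (by norm_num) hd) (magnetization_criticalProb_ge_sqrt hd)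

end Literature.Barriers.CriticalPhenomena

end
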